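import Summits.QuantumFields.YangMills.Theorems.BalabanUVNodesN15TwoGridEntry2Pieces
import Summits.QuantumFields.YangMills.Theorems.BalabanUVNodesN15TwoGridL2Entries
import HarnessLib

/-!
# N15 (NE2) — Bałaban's full propagator pair, part 68: ENTRY 2 — the SMOOTH part `S₁ + S₂` in L²-block currency and the DUALITY STEP

WHO / WHEN.  Cell `pub-ymgap`, seat `pub-ymgap-dag-n15-a` (KNIT-BY-NAME, g13); `--supports stmt-QuantumFields-20507 --as helper` (count-neutral); `HOME/pub-ymgap-dag-n15-a/DOOR-IV-PLAN.md` §7.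
Over parts 67 (`isAdj_entry2_T`), 64 (`hasMajL2_one_sub_sA_sD_comp`, `hasMajL2_ravg_comp`), 62 ((1.114) L² entries `hasMajL2_grad2_of_ineq`, `hasMajL2_gradDivAdj_of_ineq`), 61 (`hasMaj_of_adjoint`),
`B11SectG.hasMaj_comp_exp`, `B6UnitTorusCarrier` (row sums, `card_fibre_fineBond`).
WHAT.  (§103) `etaPow_mul_card_fineBond` (`η^D·#{bonds of a unit block} = d + 1`).  (§104) ★ `hasMajL2_entry2_smooth`: on one torus, from the (1.110)–(1.114) packages of both members
(`0 < ρ ≤ δ₀`): `HasMaj (L²-blocks′, η′^D) (L²-blocks, η^D) (S₁ + S₂) (η·e^{ρ}C₀(1 + (d+1)C₀K(ρ∕2))·e^{−(ρ∕2)|y−y′|_T})`, `η = (L^k)⁻¹` — `S₁ = R(1−A_μ)∇′_μG′` is `η×` the (1.114)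
entry `∇′∇′G′` (the filter defect `1 − A = −(n′L^m)⁻¹ b̃(∇′)`, part 64) averaged by `R` (Jensen); `S₂ = Σ_ν (∇_μG∇_ν^*)∘R(A_ν−1)∇′_νG′` composes the coarse (1.114) entry `∇G∇*` with the same.
(§105) ★★ `hasMaj_entry2_T`: by duality (`P† = R`, part 61's `hasMaj_of_adjoint`, `η^D·#block = d+1`) the coarse→fine operator `T2 + N₃† + N₄† − N₅†` of part 67 has the (sup → L²-block)
majorant `√(d+1)·η·e^{ρ}C₀(1 + (d+1)C₀K(ρ∕2))·e^{−(ρ∕2)|y−y′|_T}`.  Part 69 bounds `N₃†, N₄†, N₅†` and concludes `HasMaj (sup → L²) T2`.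
HONEST FRAMING ∕ LIMITS.  `U ≡ 1` torus family; L²-BLOCK output norm (the sup-norm version of entry 2 is the sequel's interpolation); count-neutral (typed 28∕28 · discharged 5∕27 of record
unchanged); NOT a discharge of N15 (`NE2PlusOperator`, object-bound); not ℝ⁴ ∕ OS ∕ mass gap ∕ Clay.
-/

open scoped BigOperators
open Finset

namespace Summit.QuantumFields.YangMills.BalabanUVNodes.N15.TwoGrid

open Literature.MathematicalPhysics.QuantumFieldTheory.Balaban1983to89
open Literature.MathematicalPhysics.QuantumFieldTheory.Balaban1983to89.B11SectG (BlockNorm HasMaj hasMaj_comp_exp)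
open Literature.MathematicalPhysics.QuantumFieldTheory.Balaban1983to89.T4EtaRateDefect (idef)
open Literature.MathematicalPhysics.QuantumFieldTheory.Balaban1983to89.T4EtaRateCoeffDefect (pull fibre)
open Literature.MathematicalPhysics.QuantumFieldTheory.Balaban1983to89.B5Prop11Plancherel (Tor fine)
open Literature.MathematicalPhysics.QuantumFieldTheory.Balaban1983to89.B5SettingP12Real (latticeSettingP12R)
open Literature.MathematicalPhysics.QuantumFieldTheory.Balaban1983to89.B5SettingP12Weighted (etaPow etaPow_nonneg)
open Literature.MathematicalPhysics.QuantumFieldTheory.King1986.Torus (blockOf tdistT tdistT_nonneg tdistT_symm)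
open Literature.MathematicalPhysics.QuantumFieldTheory.Balaban1983to89.B6UnitTorusCarrier (unitTorusGeo unitTorusGeo_dist_nonneg triangle254_unitTorusGeo rowSum_unitTorusGeo
  card_fibre_fineBond)
open Summit.QuantumFields.YangMills.BalabanUVNodes.N15.VectorPiece (blkFine kingPrV)

variable {d : ℕ}

/-! ## §103 The L²-block weight of a unit block of bonds -/

section Card

variable (M : Fin (d + 1) → ℕ) [∀ μ, NeZero (M μ)] (n : ℕ) [NeZero n]

/-- `η^{d+1}·#{(x, μ) : B(x) = y} = d + 1`. [cite: Balaban1984PropagatorsII, (2.150) p.249 (bonds in Δ(y))] -/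
theorem etaPow_mul_card_fineBond (y : Tor M) :
    etaPow n (d + 1) * ((univ.filter fun i : Tor (fine n M) × Fin (d + 1) => blockOf n M i.1 = y).card : ℝ) = (d : ℝ) + 1 := by
  have h := card_fibre_fineBond n M y
  rw [fibre] at h
  have hn : (n : ℝ) ≠ 0 := by exact_mod_cast NeZero.ne n
  rw [h]
  unfold etaPow
  push_cast
  rw [inv_pow, ← mul_assoc, mul_comm ((n : ℝ) ^ (d + 1))⁻¹, mul_assoc, inv_mul_cancel₀ (pow_ne_zero _ hn), mul_one]

end Card

/-! ## §104 ★ The smooth part `S₁ + S₂` in L²-block currency -/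

section Smooth

variable {L : ℕ} [NeZero L] (M : Fin (d + 1) → ℕ) [∀ μ, NeZero (M μ)] (k m : ℕ) (a : ℝ)

/-- ★ **`S₁ + S₂` ON ONE TORUS, EXPLICIT CONSTANTS** (see the module docstring). [cite: Balaban1984PropagatorsI, Prop. 1.2 (1.114) p.36] -/
theorem hasMajL2_entry2_smooth {K K' : ℕ} {C₀ δ₀ : ℝ} {Cα Cε : ℝ → ℝ} {Cαε : ℝ → ℝ → ℝ} (hC₀ : 0 ≤ C₀)
    (HP : B5.Ineq110_114 (latticeSettingP12R (L ^ k) M a K) C₀ Cα Cε Cαε δ₀)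
    (HP' : B5.Ineq110_114 (latticeSettingP12R (L ^ m * L ^ k) M a K') C₀ Cα Cε Cαε δ₀) {ρ : ℝ} (hρ : 0 < ρ) (hρδ : ρ ≤ δ₀) (μ : Fin (d + 1)) :
    HasMaj (BlockNorm.l2Blocks (unitTorusGeo L k M) (fun i : Tor (fine (L ^ m * L ^ k) M) × Fin (d + 1) => blockOf (L ^ m * L ^ k) M i.1)
        (etaPow (L ^ m * L ^ k) (d + 1)) (etaPow_nonneg _ _))
      (BlockNorm.l2Blocks (unitTorusGeo L k M) (blkFine L k M) (etaPow (L ^ k) (d + 1)) (etaPow_nonneg _ _))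
      (ravg M L k m ∘ₗ symbOp M (L ^ m * L ^ k) (1 - sA M (L ^ m * L ^ k) μ (L ^ m)) ∘ₗ
            symbOp M (L ^ m * L ^ k) (sD M (L ^ m * L ^ k) μ ((L ^ m * L ^ k : ℕ) : ℝ)) ∘ₗ gOp M (L ^ m * L ^ k) a
        + symbOp M (L ^ k) (sD M (L ^ k) μ ((L ^ k : ℕ) : ℝ)) ∘ₗ gOp M (L ^ k) a ∘ₗ
            (∑ ν : Fin (d + 1), symbOp M (L ^ k) (((L ^ k : ℕ) : ℝ) • (sTinv M (L ^ k) ν - 1)) ∘ₗ ravg M L k m ∘ₗ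
              symbOp M (L ^ m * L ^ k) (sA M (L ^ m * L ^ k) ν (L ^ m) - 1) ∘ₗ symbOp M (L ^ m * L ^ k) (sD M (L ^ m * L ^ k) ν ((L ^ m * L ^ k : ℕ) : ℝ))) ∘ₗ
            gOp M (L ^ m * L ^ k) a)
      (fun y y' => ((L ^ k : ℕ) : ℝ)⁻¹ * Real.exp ρ * C₀ * (1 + ((d : ℝ) + 1) * C₀ * B4Sect5Proof.latticeConst (d + 1) (ρ / 2)) * Real.exp (-(ρ / 2 * tdistT M y y'))) := by
  classical
  have hσ0 : 0 < ρ / 2 := by linarith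
  have hL0 : 0 < L := Nat.pos_of_ne_zero (NeZero.ne L)
  have hn1 : 1 ≤ L ^ k := Nat.one_le_pow _ _ hL0
  have hR0 : L ^ m ≠ 0 := pow_ne_zero m (NeZero.ne L)
  have hn'1 : 1 ≤ L ^ m * L ^ k := Nat.one_le_iff_ne_zero.mpr (Nat.mul_ne_zero hR0 (pow_ne_zero k (NeZero.ne L)))
  have hn0 : (0 : ℝ) < ((L ^ k : ℕ) : ℝ) := by exact_mod_cast hn1
  have hn'0 : (0 : ℝ) < ((L ^ m * L ^ k : ℕ) : ℝ) := by exact_mod_cast hn'1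
  have hRn : L ^ m ≤ L ^ m * L ^ k := Nat.le_mul_of_pos_right _ hn1
  have he0 : 0 ≤ Real.exp ρ := Real.exp_nonneg _
  have hη0 : 0 ≤ ((L ^ k : ℕ) : ℝ)⁻¹ := inv_nonneg.mpr hn0.le
  set KC := B4Sect5Proof.latticeConst (d + 1) (ρ / 2) with hKC
  set l2F := BlockNorm.l2Blocks (unitTorusGeo L k M) (fun i : Tor (fine (L ^ m * L ^ k) M) × Fin (d + 1) => blockOf (L ^ m * L ^ k) M i.1)
    (etaPow (L ^ m * L ^ k) (d + 1)) (etaPow_nonneg _ _) with hl2F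
  set l2C := BlockNorm.l2Blocks (unitTorusGeo L k M) (blkFine L k M) (etaPow (L ^ k) (d + 1)) (etaPow_nonneg _ _) with hl2C
  have hweak : ∀ {C : ℝ} (_ : 0 ≤ C) (y y' : Tor M), C * Real.exp (-(δ₀ * tdistT M y y')) ≤ C * Real.exp (-(ρ * tdistT M y y')) :=
    fun hC y y' => mul_le_mul_of_nonneg_left (Real.exp_le_exp.mpr (by nlinarith [tdistT_nonneg M y y'])) hC
  -- the fine (1.114) entry `∇′_ν∇′_νG′` and the filter defect `(1 − A_ν)∇′_ν G′ = O(η)`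
  have h4' : ∀ ν : Fin (d + 1), HasMaj l2F l2F
      (symbOp M (L ^ m * L ^ k) (sD M (L ^ m * L ^ k) ν ((L ^ m * L ^ k : ℕ) : ℝ)) ∘ₗ symbOp M (L ^ m * L ^ k) (sD M (L ^ m * L ^ k) ν ((L ^ m * L ^ k : ℕ) : ℝ)) ∘ₗ
        gOp M (L ^ m * L ^ k) a) (fun y y' => C₀ * Real.exp (-(ρ * tdistT M y y'))) := fun ν =>
    (hasMajL2_grad2_of_ineq (L := L) M k (L ^ m * L ^ k) a hn'1 HP' hC₀ ν ν).mono fun y y' => hweak hC₀ y y'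
  have hdef : (((L ^ m : ℕ) : ℝ) - 1) / ((L ^ m * L ^ k : ℕ) : ℝ) ≤ ((L ^ k : ℕ) : ℝ)⁻¹ := by
    rw [div_le_iff₀ hn'0]
    have hm0 : (0 : ℝ) ≤ ((L ^ m : ℕ) : ℝ) := Nat.cast_nonneg _
    have e : ((L ^ k : ℕ) : ℝ)⁻¹ * ((L ^ m * L ^ k : ℕ) : ℝ) = ((L ^ m : ℕ) : ℝ) := by
      rw [Nat.cast_mul, mul_comm, mul_assoc, mul_inv_cancel₀ hn0.ne', mul_one]
    rw [e]; linarith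
  have h1A : ∀ ν : Fin (d + 1), HasMaj l2F l2F
      (symbOp M (L ^ m * L ^ k) (1 - sA M (L ^ m * L ^ k) ν (L ^ m)) ∘ₗ symbOp M (L ^ m * L ^ k) (sD M (L ^ m * L ^ k) ν ((L ^ m * L ^ k : ℕ) : ℝ)) ∘ₗ
        gOp M (L ^ m * L ^ k) a) (fun y y' => ((L ^ k : ℕ) : ℝ)⁻¹ * Real.exp ρ * C₀ * Real.exp (-(ρ * tdistT M y y'))) := fun ν =>
    (hasMajL2_one_sub_sA_sD_comp M k (L ^ m * L ^ k) (etaPow_nonneg _ _) hC₀ hρ.le ν hR0 hRn hn'0 (h4' ν)).mono fun y y' =>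
      mul_le_mul_of_nonneg_right (mul_le_mul_of_nonneg_right (mul_le_mul_of_nonneg_right hdef he0) hC₀) (Real.exp_nonneg _)
  -- S₁
  have hS1 : HasMaj l2F l2C
      (ravg M L k m ∘ₗ symbOp M (L ^ m * L ^ k) (1 - sA M (L ^ m * L ^ k) μ (L ^ m)) ∘ₗ
        symbOp M (L ^ m * L ^ k) (sD M (L ^ m * L ^ k) μ ((L ^ m * L ^ k : ℕ) : ℝ)) ∘ₗ gOp M (L ^ m * L ^ k) a)
      (fun y y' => ((L ^ k : ℕ) : ℝ)⁻¹ * Real.exp ρ * C₀ * Real.exp (-(ρ * tdistT M y y'))) := hasMajL2_ravg_comp M k m (h1A μ)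
  -- S₂, summand by summand
  have h3 : ∀ ν : Fin (d + 1), HasMaj l2C l2C
      (symbOp M (L ^ k) (sD M (L ^ k) μ ((L ^ k : ℕ) : ℝ)) ∘ₗ gOp M (L ^ k) a ∘ₗ symbOp M (L ^ k) (((L ^ k : ℕ) : ℝ) • (sTinv M (L ^ k) ν - 1)))
      (fun y y' => C₀ * Real.exp (-(ρ * tdistT M y y'))) := fun ν =>
    (hasMajL2_gradDivAdj_of_ineq (L := L) M k (L ^ k) a hn1 HP hC₀ μ ν).mono fun y y' => hweak hC₀ y y'
  have hin : ∀ ν : Fin (d + 1), HasMaj l2F l2C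
      (ravg M L k m ∘ₗ symbOp M (L ^ m * L ^ k) (sA M (L ^ m * L ^ k) ν (L ^ m) - 1) ∘ₗ
        symbOp M (L ^ m * L ^ k) (sD M (L ^ m * L ^ k) ν ((L ^ m * L ^ k : ℕ) : ℝ)) ∘ₗ gOp M (L ^ m * L ^ k) a)
      (fun y y' => ((L ^ k : ℕ) : ℝ)⁻¹ * Real.exp ρ * C₀ * Real.exp (-(ρ * tdistT M y y'))) := by
    intro ν
    have e : symbOp M (L ^ m * L ^ k) (sA M (L ^ m * L ^ k) ν (L ^ m) - 1) = -symbOp M (L ^ m * L ^ k) (1 - sA M (L ^ m * L ^ k) ν (L ^ m)) := by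
      rw [← map_neg, neg_sub]
    refine hasMajL2_ravg_comp M k m (((h1A ν).neg).congr fun f => ?_)
    simp only [LinearMap.neg_apply, LinearMap.comp_apply, e]
  have hS2ν : ∀ ν : Fin (d + 1), HasMaj l2F l2C
      ((symbOp M (L ^ k) (sD M (L ^ k) μ ((L ^ k : ℕ) : ℝ)) ∘ₗ gOp M (L ^ k) a ∘ₗ symbOp M (L ^ k) (((L ^ k : ℕ) : ℝ) • (sTinv M (L ^ k) ν - 1))) ∘ₗ
        (ravg M L k m ∘ₗ symbOp M (L ^ m * L ^ k) (sA M (L ^ m * L ^ k) ν (L ^ m) - 1) ∘ₗ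
          symbOp M (L ^ m * L ^ k) (sD M (L ^ m * L ^ k) ν ((L ^ m * L ^ k : ℕ) : ℝ)) ∘ₗ gOp M (L ^ m * L ^ k) a))
      (fun y y' => l2C.κ * C₀ * (((L ^ k : ℕ) : ℝ)⁻¹ * Real.exp ρ * C₀) * KC * Real.exp (-(ρ / 2 * tdistT M y y'))) := fun ν =>
    hasMaj_comp_exp (b₁ := l2F) (b₂ := l2C) (b₃ := l2C) (triangle254_unitTorusGeo L k M) (unitTorusGeo_dist_nonneg L k M) (rowSum_unitTorusGeo L k M hσ0)
      hC₀ (mul_nonneg (mul_nonneg hη0 he0) hC₀) hσ0.le (by linarith) (by linarith) (h3 ν) (hin ν)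
  have hκC : l2C.κ = 1 := rfl
  have hS2 := hasMaj_finsum (g := unitTorusGeo L k M) univ _ _ fun ν _ => hS2ν ν
  refine ((hS1.add hS2).congr fun f => ?_).mono fun y y' => ?_
  · simp only [LinearMap.add_apply, LinearMap.comp_apply, LinearMap.sum_apply, map_sum]
  · rw [sum_const, card_univ, Fintype.card_fin, nsmul_eq_mul, hκC, one_mul]
    have hE : Real.exp (-(ρ * tdistT M y y')) ≤ Real.exp (-(ρ / 2 * tdistT M y y')) :=
      Real.exp_le_exp.mpr (by nlinarith [tdistT_nonneg M y y'])
    have hE0 := Real.exp_nonneg (-(ρ / 2 * tdistT M y y'))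
    have hA : 0 ≤ ((L ^ k : ℕ) : ℝ)⁻¹ * Real.exp ρ * C₀ := mul_nonneg (mul_nonneg hη0 he0) hC₀
    have hKC0 : 0 ≤ KC := B4Sect5Proof.latticeConst_nonneg (d + 1) hσ0.le
    calc ((L ^ k : ℕ) : ℝ)⁻¹ * Real.exp ρ * C₀ * Real.exp (-(ρ * tdistT M y y'))
          + ((d + 1 : ℕ) : ℝ) * (C₀ * (((L ^ k : ℕ) : ℝ)⁻¹ * Real.exp ρ * C₀) * KC * Real.exp (-(ρ / 2 * tdistT M y y')))
        ≤ ((L ^ k : ℕ) : ℝ)⁻¹ * Real.exp ρ * C₀ * Real.exp (-(ρ / 2 * tdistT M y y'))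
          + ((d + 1 : ℕ) : ℝ) * (C₀ * (((L ^ k : ℕ) : ℝ)⁻¹ * Real.exp ρ * C₀) * KC * Real.exp (-(ρ / 2 * tdistT M y y'))) := by
          gcongr
      _ = ((L ^ k : ℕ) : ℝ)⁻¹ * Real.exp ρ * C₀ * (1 + ((d : ℝ) + 1) * C₀ * KC) * Real.exp (-(ρ / 2 * tdistT M y y')) := by push_cast; ring

/-! ## §105 ★★ The duality step: `T2 + N₃† + N₄† − N₅†` in (sup → L²-block) currency -/

/-- ★★ **DUALITY**: the coarse→fine operator `T2 + N₃† + N₄† − N₅†` (adjoint to `S₁ + S₂`, part 67) has the (sup → L²-block) majorant `√(d+1)·η·e^{ρ}C₀(1 + (d+1)C₀K(ρ∕2))·e^{−(ρ∕2)d}`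
(part 61's `hasMaj_of_adjoint` with `η^D·#block = d+1`). [cite: Balaban1984PropagatorsI, Prop. 1.1 p.33 (symmetry of G), Prop. 1.2 (1.114) p.36] -/
theorem hasMaj_entry2_T (ha : 0 < a) {K K' : ℕ} {C₀ δ₀ : ℝ} {Cα Cε : ℝ → ℝ} {Cαε : ℝ → ℝ → ℝ} (hC₀ : 0 ≤ C₀)
    (HP : B5.Ineq110_114 (latticeSettingP12R (L ^ k) M a K) C₀ Cα Cε Cαε δ₀)
    (HP' : B5.Ineq110_114 (latticeSettingP12R (L ^ m * L ^ k) M a K') C₀ Cα Cε Cαε δ₀) {ρ : ℝ} (hρ : 0 < ρ) (hρδ : ρ ≤ δ₀) (μ : Fin (d + 1)) :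
    HasMaj (BlockNorm.ofBlocks (unitTorusGeo L k M) (blkFine L k M))
      (BlockNorm.l2Blocks (unitTorusGeo L k M) (fun i : Tor (fine (L ^ m * L ^ k) M) × Fin (d + 1) => blockOf (L ^ m * L ^ k) M i.1)
        (etaPow (L ^ m * L ^ k) (d + 1)) (etaPow_nonneg _ _))
      (idef (pull (kingPrV L k m M)) (pull (kingPrV L k m M))
          (gOp M (L ^ m * L ^ k) a ∘ₗ symbOp M (L ^ m * L ^ k) (((L ^ m * L ^ k : ℕ) : ℝ) • (sTinv M (L ^ m * L ^ k) μ - 1)))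
          (gOp M (L ^ k) a ∘ₗ symbOp M (L ^ k) (((L ^ k : ℕ) : ℝ) • (sTinv M (L ^ k) μ - 1)))
        + gOp M (L ^ m * L ^ k) a ∘ₗ
          (∑ ν : Fin (d + 1), symbOp M (L ^ m * L ^ k) (((L ^ m * L ^ k : ℕ) : ℝ) • (sTinv M (L ^ m * L ^ k) ν - 1)) ∘ₗ
            symbOp M (L ^ m * L ^ k) (sD M (L ^ m * L ^ k) ν ((L ^ m * L ^ k : ℕ) : ℝ)) ∘ₗ symbOp M (L ^ m * L ^ k) (1 - sA M (L ^ m * L ^ k) ν (L ^ m)) ∘ₗ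
              pull (kingPrV L k m M)) ∘ₗ
          gOp M (L ^ k) a ∘ₗ symbOp M (L ^ k) (((L ^ k : ℕ) : ℝ) • (sTinv M (L ^ k) μ - 1))
        + gOp M (L ^ m * L ^ k) a ∘ₗ (pull (kingPrV L k m M) ∘ₗ landauRe M (L ^ k) - landauRe M (L ^ m * L ^ k) ∘ₗ pull (kingPrV L k m M)) ∘ₗ
          gOp M (L ^ k) a ∘ₗ symbOp M (L ^ k) (((L ^ k : ℕ) : ℝ) • (sTinv M (L ^ k) μ - 1))
        - gOp M (L ^ m * L ^ k) a ∘ₗ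
          (pull (kingPrV L k m M) ∘ₗ (a • (qvAdjRe M (L ^ k) ∘ₗ qvRe M (L ^ k))) - (a • (qvAdjRe M (L ^ m * L ^ k) ∘ₗ qvRe M (L ^ m * L ^ k))) ∘ₗ pull (kingPrV L k m M)) ∘ₗ
          gOp M (L ^ k) a ∘ₗ symbOp M (L ^ k) (((L ^ k : ℕ) : ℝ) • (sTinv M (L ^ k) μ - 1)))
      (fun y y' => Real.sqrt ((d : ℝ) + 1) * (((L ^ k : ℕ) : ℝ)⁻¹ * Real.exp ρ * C₀ * (1 + ((d : ℝ) + 1) * C₀ * B4Sect5Proof.latticeConst (d + 1) (ρ / 2)))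
        * Real.exp (-(ρ / 2 * tdistT M y y'))) := by
  classical
  haveI : NeZero (L ^ k) := ⟨pow_ne_zero k (NeZero.ne L)⟩
  have hσ0 : 0 < ρ / 2 := by linarith
  have hn0 : (0 : ℝ) < ((L ^ k : ℕ) : ℝ) := by exact_mod_cast Nat.one_le_pow _ _ (Nat.pos_of_ne_zero (NeZero.ne L))
  have hS := hasMajL2_entry2_smooth (L := L) M k m a hC₀ HP HP' hρ hρδ μ
  have hB : 0 ≤ ((L ^ k : ℕ) : ℝ)⁻¹ * Real.exp ρ * C₀ * (1 + ((d : ℝ) + 1) * C₀ * B4Sect5Proof.latticeConst (d + 1) (ρ / 2)) := by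
    have := B4Sect5Proof.latticeConst_nonneg (d + 1) hσ0.le
    have : 0 ≤ ((d : ℝ) + 1) * C₀ * B4Sect5Proof.latticeConst (d + 1) (ρ / 2) := by positivity
    exact mul_nonneg (mul_nonneg (mul_nonneg (inv_nonneg.mpr hn0.le) (Real.exp_nonneg _)) hC₀) (by linarith)
  have hω : ∀ y : Tor M, etaPow (L ^ k) (d + 1) * ((univ.filter fun i : Tor (fine (L ^ k) M) × Fin (d + 1) => blkFine L k M i = y).card : ℝ) ≤ (d : ℝ) + 1 :=
    fun y => (etaPow_mul_card_fineBond M (L ^ k) y).le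
  have h := hasMaj_of_adjoint (g := unitTorusGeo L k M) (etaPow_nonneg (L ^ k) (d + 1)) (etaPow_nonneg (L ^ m * L ^ k) (d + 1)) hω
    (isAdj_iff.1 (isAdj_entry2_T (L := L) M k m a ha μ)) (fun y y' => mul_nonneg hB (Real.exp_nonneg _)) hS
  exact h.mono fun y y' => by rw [tdistT_symm M y' y]; exact le_of_eq (by ring)

end Smooth

end Summit.QuantumFields.YangMills.BalabanUVNodes.N15.TwoGrid
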